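import Literature.NumberTheory.EllipticCurves.PlusMinusPAdicLFunction
import Summits.BirchSwinnertonDyer.Rank1Residual.X2.GreenbergVatsalAnalyticTransferCore
import Summits.BirchSwinnertonDyer.BirchSwinnertonDyer.Theorems.ResidualThetaTransportAtTwoResidualThetaMainConjectureAtTwoLayerToolkit
import HarnessLib

/-!
# Crux `ResidualThetaMainConjectureAtTwo` (stmt-BirchSwinnertonDyer-20787), line `birth`, stub R2 —
# an INTEGRAL MODEL of a Mazur–Tate layer element from a Pollack congruence `θ ≡ ω·L (mod ω_n)`

Cell `bsd-wall`, seat `bsd-wall-rtt-p2` (LEAD PROVER, line mode); helper for stub R2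
`stub_analyticLayerLawAtTwo`. THEOREMS ONLY (no `def`, no named fact, no `sorry`); pure `Λ`-algebra,
any prime `p`.

THE STEP (Pollack 2003 Prop. 6.18 ⟹ Kurihara/Pollack's `λ(θ_n) = q_n + λ(L^∓)`, read in the kernel's
currencies). Let `θ ∈ ℚ[X]` have no coefficient in degree `≥ pⁿ` (a Mazur–Tate element at layer `n`,
`mazurTateElement f p n`), `ω ∈ ℤ[X]` with `ω ≡ u·X^d (mod p)`, `u ∈ 𝔽_pˣ` (e.g. `±ω_n^∓`, `d = q_n`),
and `0 ≠ L ∈ Λ = ℤ_p⟦T⟧` with `θ ≡ ω·L (mod ω_n)` in `Λ ⊗ ℚ_p` (tree `IsCongrModOmega p n θ ω L`: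
`p^m(θ − ω L) = ω_n q`). Write `L = p^μ L₀`, `p ∤ L₀`, `λ = lam L = ord_T(L₀ mod p)`
(`X1.MuLambda`). If `d + λ < pⁿ` then:

* `q` is divisible by `p^{m+μ}` (`Θ := p^{m+μ} ω L₀ + ω_n q = p^m θ` has no coefficient in degree
  `≥ pⁿ`, while `ω_n ≡ X^{pⁿ} (mod p)` pushes any `p`-free part of `q` up there), so
* `θ = p^μ · Ψ` with `Ψ = ω L₀ + ω_n q₁ ∈ ℤ_p[X]` of degree `< pⁿ` and
  `Ψ ≡ u X^d L₀ (mod p, X^{pⁿ})`, whence `ord_X(Ψ mod p) = d + λ`.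

Main theorem **`exists_integralModel_of_isCongrModOmega`**: `∃ P ∈ ℤ_p[X], ∃ μ,
θ = p^μ · P` in `ℚ_p[X]` and `ord_X(P mod p) = d + lam L`. With the toolkit
(`layerLambda_map_eq_of_order`, `layerLambda_C_mul`) this gives `λ_layer(θ) = d + lam L` for the
image of `θ` in `ℚ̄_p[X]`; stub R2 applies it to `θ_n(f_W)`, `ω = (−1)^{n/2+1} ω_n^-`, `L = L⁻`
(`IsPollackPair`, even `n`).

References: R. Pollack, Duke Math. J. 118 (2003) Prop. 6.18, Prop. 6.9 [Pollack2003];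
M. Kurihara, Invent. Math. 149 (2002) [Kurihara2002]; R. Pollack, T. Weston, Duke Math. J. 156 (2011)
§3–§4 [PollackWeston2011MT]; L. Washington, GTM 83, §7.1 [Washington1997].
-/

set_option linter.dupNamespace false
set_option autoImplicit false

noncomputable section

open scoped Classical

open Polynomial Literature.NumberTheory.EllipticCurves Summit.BirchSwinnertonDyer.Rank1Residual.X1.MuLambda
  Summit.BirchSwinnertonDyer.Rank1Residual.X2.GreenbergVatsalAnalyticTransferCore

namespace Summit.BirchSwinnertonDyer.BirchSwinnertonDyer.Theorems.ResidualThetaLayer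

section Aux

variable {R S : Type*} [CommSemiring R] [CommSemiring S]

/-- Coercion to power series commutes with `map`. [folklore] -/
theorem map_coe_polynomial (f : R →+* S) (P : R[X]) :
    PowerSeries.map f (P : PowerSeries R) = ((P.map f : S[X]) : PowerSeries S) := by
  ext j
  rw [PowerSeries.coeff_map, Polynomial.coeff_coe, Polynomial.coeff_coe, Polynomial.coeff_map]

end Aux

section Model

variable {p : ℕ} [hp : Fact p.Prime]

/-- The two reductions of `ℤ_p` (`toZMod : ℤ_p → ℤ/p` and the residue map) have the same kernel, so
`red g ≠ 0 ↔ (g mod p) ≠ 0` in `𝔽_p⟦T⟧` vs `(ℤ/p)⟦T⟧`. [cite: Washington1997, §7.1] -/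
theorem map_toZMod_ne_zero_of_red_ne_zero {g : IwasawaAlgebra p} (hg : red g ≠ 0) :
    PowerSeries.map (PadicInt.toZMod (p := p)) g ≠ 0 := by
  intro h
  apply hg
  ext j
  have hj := PowerSeries.ext_iff.mp h j
  rw [PowerSeries.coeff_map, map_zero, ← RingHom.mem_ker, PadicInt.ker_toZMod] at hj
  rw [red, PowerSeries.coeff_map, map_zero, IsLocalRing.residue_eq_zero_iff]
  exact hj

/-- `ord_T(L₀ mod p) = lam L` for `L₀ = pfree L`, `L ≠ 0` (the `λ`-invariant read on `ℤ/p`).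
[cite: Washington1997, §7.1] -/
theorem order_map_toZMod_pfree_eq_lam {L : IwasawaAlgebra p} (hL : L ≠ 0) :
    (PowerSeries.map (PadicInt.toZMod (p := p)) (pfree L)).order = (lam L : ℕ) := by
  rw [order_map_toZMod_eq_order_red, lam]
  exact (ENat.coe_toNat fun h ↦ red_pfree_ne_zero hL (PowerSeries.order_eq_top.mp h)).symm

/-- The reduction of `ω_n = (X+1)^{pⁿ} − 1 ∈ Λ` is `X^{pⁿ}`. [cite: Washington1997, §7.1] -/
theorem map_toZMod_cyclotomicOmega (n : ℕ) :
    PowerSeries.map (PadicInt.toZMod (p := p))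
        ((((cyclotomicOmega p n).map (Int.castRingHom ℤ_[p]) : ℤ_[p][X])) : PowerSeries ℤ_[p]) =
      PowerSeries.X ^ p ^ n := by
  rw [map_coe_polynomial, Polynomial.map_map,
    RingHom.ext_int ((PadicInt.toZMod (p := p)).comp (Int.castRingHom ℤ_[p])) (Int.castRingHom (ZMod p)),
    cyclotomicOmega, Polynomial.map_sub, Polynomial.map_pow, Polynomial.map_add, Polynomial.map_X,
    Polynomial.map_one, X_add_one_pow_prime_pow_sub_one p n, Polynomial.coe_pow, Polynomial.coe_X]

/-- The reduction of `C (p^{k+1})` vanishes. [folklore] -/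
theorem map_toZMod_C_p_pow_succ (k : ℕ) :
    PowerSeries.map (PadicInt.toZMod (p := p)) (PowerSeries.C ((p : ℤ_[p]) ^ (k + 1))) = 0 := by
  rw [PowerSeries.map_C, map_pow, map_natCast, ZMod.natCast_self, zero_pow (Nat.succ_ne_zero k),
    map_zero]

/-- **Integral model of a layer element from a Pollack congruence.** Let `θ ∈ ℚ[X]` with
`θ_j = 0` for `j ≥ pⁿ`, `ω ∈ ℤ[X]` with `ω mod p = u·X^d`, `u ≠ 0`, `0 ≠ L ∈ Λ`, and
`θ ≡ ω·L (mod ω_n)` in `Λ ⊗ ℚ_p` (`IsCongrModOmega p n θ ω L`). If `d + lam L < pⁿ` then there are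
`P ∈ ℤ_p[X]` and `μ ∈ ℕ` (namely `μ = μ(L)`, `P = ω·L₀ + ω_n·q₁` truncated) with
`θ = p^μ · P` in `ℚ_p[X]` and `ord_X(P mod p) = d + lam L`. This is the algebra of
"`θ_n ≡ ω_n^∓ L^∓ (mod ω_n)` ⟹ `λ(θ_n) = deg ω_n^∓ + λ(L^∓)` for `n ≫ 0`" (Pollack 2003 Prop. 6.18 with
Prop. 6.9 / Kurihara 2002; Pollack–Weston 2011 §4), valid at every prime `p`.
[cite: Pollack2003, Prop. 6.18 and Prop. 6.9] [cite: PollackWeston2011MT, §3.1 and §4] -/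
theorem exists_integralModel_of_isCongrModOmega {n : ℕ} {θ : ℚ[X]} {ω : ℤ[X]}
    {L : IwasawaAlgebra p} {u : ZMod p} {d : ℕ} (hcong : IsCongrModOmega p n θ ω L) (hL : L ≠ 0)
    (hθ : ∀ j, p ^ n ≤ j → θ.coeff j = 0) (hω : ω.map (Int.castRingHom (ZMod p)) = C u * X ^ d)
    (hu : u ≠ 0) (hd : d + lam L < p ^ n) :
    ∃ (P : ℤ_[p][X]) (μ : ℕ),
      θ.map (algebraMap ℚ ℚ_[p]) = C ((p : ℚ_[p]) ^ μ) * P.map (algebraMap ℤ_[p] ℚ_[p]) ∧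
      ((P.map (PadicInt.toZMod (p := p)) : (ZMod p)[X]) : PowerSeries (ZMod p)).order =
        ((d + lam L : ℕ) : ℕ∞) := by
  obtain ⟨m, q, hmq⟩ := hcong
  -- notation: `ι`, `ωΛ`, `ωn`, `θ'`, `bar`
  set ωΛ : IwasawaAlgebra p := ((ω.map (Int.castRingHom ℤ_[p]) : ℤ_[p][X]) : PowerSeries ℤ_[p])
    with hωΛ
  set ωn : IwasawaAlgebra p :=
    (((cyclotomicOmega p n).map (Int.castRingHom ℤ_[p]) : ℤ_[p][X]) : PowerSeries ℤ_[p]) with hωn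
  set θ' : PowerSeries ℚ_[p] := ((θ.map (algebraMap ℚ ℚ_[p]) : ℚ_[p][X]) : PowerSeries ℚ_[p])
    with hθ'
  have hp0 : (p : ℤ_[p]) ≠ 0 := by exact_mod_cast hp.out.ne_zero
  -- `L = p^μ L₀`
  set μ := mu L with hμ
  set L₀ := pfree L with hL₀def
  have hLfac : L = PowerSeries.C ((p : ℤ_[p]) ^ μ) * L₀ := eq_C_pow_mu_mul_pfree L
  have hL₀ : red L₀ ≠ 0 := red_pfree_ne_zero hL
  -- `Θ = p^{m+μ} ω L₀ + ω_n q`, `ι Θ = p^m θ`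
  set M := m + μ with hM
  set Θ : IwasawaAlgebra p := PowerSeries.C ((p : ℤ_[p]) ^ M) * (ωΛ * L₀) + ωn * q with hΘ
  have hkey : PowerSeries.C ((p : ℤ_[p]) ^ M) * (ωΛ * L₀) =
      PowerSeries.C ((p : ℤ_[p]) ^ m) * (ωΛ * L) := by
    rw [hLfac, hM, pow_add, map_mul]; ring
  have hιΘ : iwasawaToPowerSeries p Θ = PowerSeries.C ((p : ℚ_[p]) ^ m) * θ' := by
    have h1 := hmq
    rw [mul_sub, sub_eq_iff_eq_add] at h1
    rw [h1, hΘ, hkey, map_add, map_mul (iwasawaToPowerSeries p) (PowerSeries.C _), iwasawaToPowerSeries,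
      PowerSeries.map_C, map_pow, map_natCast, add_comm]
  have hΘcoeff : ∀ j, p ^ n ≤ j → PowerSeries.coeff j Θ = 0 := by
    intro j hj
    have h1 : PowerSeries.coeff j (iwasawaToPowerSeries p Θ) = 0 := by
      rw [hιΘ, PowerSeries.coeff_C_mul, hθ', Polynomial.coeff_coe, Polynomial.coeff_map, hθ j hj, map_zero,
        mul_zero]
    rw [iwasawaToPowerSeries, PowerSeries.coeff_map] at h1
    exact (IsFractionRing.injective ℤ_[p] ℚ_[p]) (by rw [h1, map_zero])
  -- reductions mod `p`
  have hbarω : PowerSeries.map (PadicInt.toZMod (p := p)) ωΛ = PowerSeries.C u * PowerSeries.X ^ d := by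
    rw [hωΛ, map_coe_polynomial, Polynomial.map_map,
      RingHom.ext_int ((PadicInt.toZMod (p := p)).comp (Int.castRingHom ℤ_[p])) (Int.castRingHom (ZMod p)),
      hω, Polynomial.coe_mul, Polynomial.coe_C, Polynomial.coe_pow, Polynomial.coe_X]
  have hbarωn : PowerSeries.map (PadicInt.toZMod (p := p)) ωn = PowerSeries.X ^ p ^ n :=
    map_toZMod_cyclotomicOmega n
  -- CLAIM A: `p^M ∣ q`
  have hq : ∃ q₁ : IwasawaAlgebra p, q = PowerSeries.C ((p : ℤ_[p]) ^ M) * q₁ := by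
    by_cases hq0 : q = 0
    · exact ⟨0, by rw [hq0, mul_zero]⟩
    set k := mu q with hk
    set q₀ := pfree q with hq₀def
    have hqfac : q = PowerSeries.C ((p : ℤ_[p]) ^ k) * q₀ := eq_C_pow_mu_mul_pfree q
    have hq₀ : red q₀ ≠ 0 := red_pfree_ne_zero hq0
    by_cases hkM : M ≤ k
    · obtain ⟨e, he⟩ := Nat.exists_eq_add_of_le hkM
      exact ⟨PowerSeries.C ((p : ℤ_[p]) ^ e) * q₀, by rw [hqfac, he, pow_add, map_mul, mul_assoc]⟩
    · exfalso
      obtain ⟨e, he⟩ := Nat.exists_eq_add_of_lt (not_le.mp hkM)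
      set Θ' : IwasawaAlgebra p := PowerSeries.C ((p : ℤ_[p]) ^ (e + 1)) * (ωΛ * L₀) + ωn * q₀ with hΘ'
      have hΘfac : Θ = PowerSeries.C ((p : ℤ_[p]) ^ k) * Θ' := by
        rw [hΘ, hqfac, hΘ', he, show k + e + 1 = k + (e + 1) by ring, pow_add, map_mul]; ring
      have hbar : PowerSeries.map (PadicInt.toZMod (p := p)) Θ' =
          PowerSeries.X ^ p ^ n * PowerSeries.map (PadicInt.toZMod (p := p)) q₀ := by
        rw [hΘ']
        simp only [map_add, map_mul]
        rw [map_toZMod_C_p_pow_succ, zero_mul, zero_add, hbarωn]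
      have hq₀bar : PowerSeries.map (PadicInt.toZMod (p := p)) q₀ ≠ 0 := map_toZMod_ne_zero_of_red_ne_zero hq₀
      obtain ⟨i, hi⟩ : ∃ i, PowerSeries.coeff i (PowerSeries.map (PadicInt.toZMod (p := p)) q₀) ≠ 0 := by
        by_contra h
        push Not at h
        exact hq₀bar (PowerSeries.ext fun j ↦ by rw [h j, map_zero])
      have h1 : PowerSeries.coeff (p ^ n + i) (PowerSeries.map (PadicInt.toZMod (p := p)) Θ') ≠ 0 := by
        rw [hbar, PowerSeries.coeff_X_pow_mul', if_pos (Nat.le_add_right _ _), Nat.add_sub_cancel_left]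
        exact hi
      have h2 : PowerSeries.coeff (p ^ n + i) Θ' ≠ 0 := by
        intro h0
        apply h1
        rw [PowerSeries.coeff_map, h0, map_zero]
      have h3 : PowerSeries.coeff (p ^ n + i) Θ = 0 := hΘcoeff _ (Nat.le_add_right _ _)
      rw [hΘfac, PowerSeries.coeff_C_mul, mul_eq_zero] at h3
      rcases h3 with h3 | h3
      · exact pow_ne_zero _ hp0 h3
      · exact h2 h3
  obtain ⟨q₁, hq₁⟩ := hq
  -- `Ψ = ω L₀ + ω_n q₁`, `Θ = p^M Ψ`
  set Ψ : IwasawaAlgebra p := ωΛ * L₀ + ωn * q₁ with hΨ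
  have hΘΨ : Θ = PowerSeries.C ((p : ℤ_[p]) ^ M) * Ψ := by rw [hΘ, hq₁, hΨ]; ring
  have hΨcoeff : ∀ j, p ^ n ≤ j → PowerSeries.coeff j Ψ = 0 := by
    intro j hj
    have h1 := hΘcoeff j hj
    rw [hΘΨ, PowerSeries.coeff_C_mul, mul_eq_zero] at h1
    exact h1.resolve_left (pow_ne_zero _ hp0)
  have hbarΨ : ∀ j, j < p ^ n →
      PowerSeries.coeff j (PowerSeries.map (PadicInt.toZMod (p := p)) Ψ) =
        u * (if d ≤ j then PowerSeries.coeff (j - d) (PowerSeries.map (PadicInt.toZMod (p := p)) L₀) else 0) := by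
    intro j hj
    rw [hΨ, map_add, map_mul, map_mul, hbarω, hbarωn, map_add, mul_assoc, PowerSeries.coeff_C_mul,
      PowerSeries.coeff_X_pow_mul', PowerSeries.coeff_X_pow_mul', if_neg (not_le.mpr hj), add_zero]
  -- `ord_T(L₀ mod p) = lam L`
  have hlam := order_map_toZMod_pfree_eq_lam hL
  rw [← hL₀def, PowerSeries.order_eq_nat] at hlam
  obtain ⟨hlamne, hlamlt⟩ := hlam
  -- the polynomial `P = trunc_{pⁿ} Ψ`
  set P : ℤ_[p][X] := PowerSeries.trunc (p ^ n) Ψ with hP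
  have hPΨ : (P : PowerSeries ℤ_[p]) = Ψ := by
    ext j
    rw [Polynomial.coeff_coe, hP, PowerSeries.coeff_trunc]
    split_ifs with h
    · rfl
    · exact (hΨcoeff j (not_lt.mp h)).symm
  refine ⟨P, μ, ?_, ?_⟩
  · -- `θ = p^μ · P` in `ℚ_p[X]`
    have hθΨ : θ' = PowerSeries.C ((p : ℚ_[p]) ^ μ) * iwasawaToPowerSeries p Ψ := by
      have h1 : PowerSeries.C ((p : ℚ_[p]) ^ m) * θ' =
          PowerSeries.C ((p : ℚ_[p]) ^ m) * (PowerSeries.C ((p : ℚ_[p]) ^ μ) * iwasawaToPowerSeries p Ψ) := by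
        rw [← hιΘ, hΘΨ, map_mul, iwasawaToPowerSeries, PowerSeries.map_C, map_pow, map_natCast, hM, pow_add,
          map_mul, mul_assoc]
      have hC : PowerSeries.C ((p : ℚ_[p]) ^ m) ≠ 0 := by
        rw [Ne, ← map_zero (PowerSeries.C (R := ℚ_[p])), PowerSeries.C_injective.eq_iff]
        exact pow_ne_zero _ (by exact_mod_cast hp.out.ne_zero)
      exact mul_left_cancel₀ hC h1
    apply Polynomial.coe_inj.mp
    rw [Polynomial.coe_mul, Polynomial.coe_C, ← map_coe_polynomial (algebraMap ℤ_[p] ℚ_[p]) P, hPΨ, ← hθ',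
      hθΨ]
  · -- `ord_X(P mod p) = d + lam L`
    rw [PowerSeries.order_eq_nat]
    refine ⟨?_, fun i hi ↦ ?_⟩
    · rw [Polynomial.coeff_coe, Polynomial.coeff_map, hP, PowerSeries.coeff_trunc, if_pos hd,
        ← PowerSeries.coeff_map, hbarΨ _ hd, if_pos (Nat.le_add_right d _), Nat.add_sub_cancel_left]
      exact mul_ne_zero hu hlamne
    · rw [Polynomial.coeff_coe, Polynomial.coeff_map, hP, PowerSeries.coeff_trunc, if_pos (hi.trans hd),
        ← PowerSeries.coeff_map, hbarΨ _ (hi.trans hd)]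
      split_ifs with hdi
      · rw [hlamlt (i - d) (by omega), mul_zero]
      · rw [mul_zero]

end Model

end Summit.BirchSwinnertonDyer.BirchSwinnertonDyer.Theorems.ResidualThetaLayer

end
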